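import Summits.Ventures.CertifiedArithmetic.LowPrec.SRPythagorasTrunc
import HarnessLib

/-!
# Stochastic rounding in low-precision formats CXIII — the AVERAGED alignment gain: a fair `±σ`
# jitter moves the StochasticA step mean by at most half a sub-quantum

HONEST FRAMING: certified error envelopes and provably optimal rounding/accumulation schemes for
low-precision formats under stated cost models; every table by two implementations; no hardware or
vendor claims.

THE FACT.  For IEEE P3109 `StochasticA` with `N` random bits (`SR_{p,r}` of [ElararEtAl2025]) on a
nonnegative cell of width `2^N·ρ`, the one-step mean is `τ(c) = c − resid (c − ⌊c̄⌋) ρ` (XCIII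
`stepQA_cell`): the truncation error is the offset read modulo the sub-quantum `ρ`, a sawtooth of
slope `1` with drops of height `ρ`.  Hence, from the floor inequality
`2⌊a⌋ − 1 ≤ ⌊a + b⌋ + ⌊a − b⌋ ≤ 2⌊a⌋ + 1` (`floor_two_point`), for EVERY shift `σ`
(`resid_two_point`):

    2·resid y ρ − ρ ≤ resid (y + σ) ρ + resid (y − σ) ρ ≤ 2·resid y ρ + ρ

— the two symmetric shifts cross at most one more (or one fewer) multiple of `ρ` than twice the
unshifted count: "exactly one branch wraps".  Therefore (`stepQA_pair_gain`), for `c − σ`, `c`,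
`c + σ` in nonnegative cells of the same width `2^N·ρ` (or degenerate) whose left endpoints are
congruent modulo the width (the situation `NestedWindow.coarse` of CVI produces inside one block
of a nested window), the AVERAGED GAIN of the step mean under a fair `±σ` jitter obeys

    −ρ/2 ≤ (τ(c + σ) + τ(c − σ))/2 − τ(c) ≤ ρ/2      (every `σ`; one cell: `stepQA_pair_gain_cell`).

Both bounds are attained on E3M2 (`Formats.e3m2_pair_gain_attained`: cell width `2`, one bit,
`ρ = 1`, `σ = 1/2`: `c = 43/4` gains `+1/2`, `c = 41/4` gains `−1/2`; the aligned jitter `σ = 1`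
at `c = 21/2` gains `0`).

WHY IT IS RECORDED (gen 20).  This is the lever behind the REFUTATION of the variance conjecture
`VAR-LE` (CXI `SRPythagorasVariance`, docstring STATUS; certificates gen20/ratchet, gen20/ratchet2):
in the ratchet families the upper sibling is split fairly by `±σ = ±ρ'/2` in a cell `N` binades down
and then re-rounded in the top block (sub-quantum `ρ = G/2^N`), the lower sibling is not jittered;
by the upper bound the jittered branch out-drifts the unjittered one by at most `ρ/2 = G/2^{N+1}`
per cycle in conditional mean — and the ratchet ATTAINS `ρ/2` every cycle, so the root mean gap
grows like `G(1 + m/2^{N+1})` and `Var ŝₙ` (which counts `π(1−π)D²`, CXI `accExpQ_var_eq_varQ`)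
eventually exceeds `n·G²/4` (`n = 39` at `N = 1`, `n = 199` at `N = 2`).  For the surviving
conjecture `NOISE-LE` (`𝒩 ≤ n·G²/4`, CX) the same bound caps the differential bias ONE
return-to-a-coarser-cell can create between sibling subtrees at `ρ/2`, the quantity a proof on the
bias side has to charge against the noise deficit of the fine excursion (HANDOFF gen 21 strategy
memo).  CVI's lever (`stepQA_lever_of_jump`: `0 ≤ τ(c') − τ(c) ≤ c' − c` for ALIGNED pairs, `c' − c
∈ ρℤ`-type hypotheses) is the zero-gain case; this file is the misaligned, averaged complement.

Scope (honest): one-step statements about conditional means inside cells of equal width with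
congruent endpoints, nonnegative cells (`0 ≤ ⌊c̄⌋`, where `StochasticA` is the truncation rule); no
tree-level theorem is claimed here.  Prior art: the bias of `SR_{p,r}` is the truncation error
`RD_{p+r}(x) − x` [ElararEtAl2025, §3, Rem. 3 and the display before it, p. 7];
[ConnollyHighamMary2021, §2]; no Mathlib precedent for the two-point floor inequality in this form
(`Int.le_floor_add`, `Int.le_floor_add_floor` are the one-sided summands).
-/


namespace Summit.Ventures.CertifiedArithmetic.LowPrec.SR

open Literature.ComputerArithmetic.ConnollyHighamMary2021
open Finset

variable {K : Type*} [Field K] [LinearOrder K] [IsStrictOrderedRing K] [FloorRing K]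

namespace LimitedBits

/-! ### Floors of a symmetric pair -/

/-- `2⌊a⌋ − 1 ≤ ⌊a + b⌋ + ⌊a − b⌋ ≤ 2⌊a⌋ + 1`: the two symmetric shifts cross, in total, the
number of integers crossed by `2a` give or take one. -/
theorem floor_two_point (a b : K) :
    2 * ⌊a⌋ - 1 ≤ ⌊a + b⌋ + ⌊a - b⌋ ∧ ⌊a + b⌋ + ⌊a - b⌋ ≤ 2 * ⌊a⌋ + 1 := by
  have h1 := Int.floor_le a
  have h2 := Int.lt_floor_add_one a
  have h3 := Int.floor_le (a + b)
  have h4 := Int.lt_floor_add_one (a + b)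
  have h5 := Int.floor_le (a - b)
  have h6 := Int.lt_floor_add_one (a - b)
  have up : ((⌊a + b⌋ + ⌊a - b⌋ : ℤ) : K) < ((2 * ⌊a⌋ + 2 : ℤ) : K) := by push_cast; linarith
  have dn : ((2 * ⌊a⌋ - 2 : ℤ) : K) < ((⌊a + b⌋ + ⌊a - b⌋ : ℤ) : K) := by push_cast; linarith
  have up' := Int.cast_lt.mp up
  have dn' := Int.cast_lt.mp dn
  constructor <;> omega

/-! ### Residues of a symmetric pair -/

/-- **"Exactly one branch wraps."**  For every shift `σ`:
`2·(y mod ρ) − ρ ≤ (y + σ) mod ρ + (y − σ) mod ρ ≤ 2·(y mod ρ) + ρ`. -/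
theorem resid_two_point {y ρ : K} (hρ : 0 < ρ) (σ : K) :
    2 * resid y ρ - ρ ≤ resid (y + σ) ρ + resid (y - σ) ρ ∧
      resid (y + σ) ρ + resid (y - σ) ρ ≤ 2 * resid y ρ + ρ := by
  unfold resid
  rw [add_div, sub_div]
  obtain ⟨k1, k2⟩ := floor_two_point (y / ρ) (σ / ρ)
  have k1' : (2 * ⌊y / ρ⌋ - 1 : K) ≤ (⌊y / ρ + σ / ρ⌋ : K) + ⌊y / ρ - σ / ρ⌋ := by exact_mod_cast k1
  have k2' : (⌊y / ρ + σ / ρ⌋ : K) + ⌊y / ρ - σ / ρ⌋ ≤ 2 * ⌊y / ρ⌋ + 1 := by exact_mod_cast k2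
  constructor <;>
    nlinarith [mul_le_mul_of_nonneg_left k1' hρ.le, mul_le_mul_of_nonneg_left k2' hρ.le]

/-- Truncation errors under a fair `±σ` jitter of the offset: the average error drops by at most
`ρ/2` (and rises by at most `ρ/2`). -/
theorem resid_jitter_avg {y ρ : K} (hρ : 0 < ρ) (σ : K) :
    resid y ρ - ρ / 2 ≤ (resid (y + σ) ρ + resid (y - σ) ρ) / 2 ∧
      (resid (y + σ) ρ + resid (y - σ) ρ) / 2 ≤ resid y ρ + ρ / 2 := by
  obtain ⟨h1, h2⟩ := resid_two_point hρ σ (y := y)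
  constructor <;> linarith

/-! ### The averaged gain of the StochasticA step mean -/

/-- **Averaged alignment gain.**  `c − σ`, `c`, `c + σ` lie in nonnegative cells that are degenerate
or of width `2^N·ρ`, with left endpoints congruent to `⌊c̄⌋` modulo `2^N·ρ`.  Then the mean of one
StochasticA step with `N` random bits satisfies
`−ρ/2 ≤ (τ(c + σ) + τ(c − σ))/2 − τ(c) ≤ ρ/2` — for every `σ`. -/
theorem stepQA_pair_gain (F : Finset K) (N : ℕ) {c σ ρ : K} (hρ : 0 < ρ)
    (hc : InHull F c) (hcp : InHull F (c + σ)) (hcm : InHull F (c - σ))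
    (hd : 0 ≤ dn F c) (hdp : 0 ≤ dn F (c + σ)) (hdm : 0 ≤ dn F (c - σ))
    (hw : up F c = dn F c ∨ up F c = dn F c + 2 ^ N * ρ)
    (hwp : up F (c + σ) = dn F (c + σ) ∨ up F (c + σ) = dn F (c + σ) + 2 ^ N * ρ)
    (hwm : up F (c - σ) = dn F (c - σ) ∨ up F (c - σ) = dn F (c - σ) + 2 ^ N * ρ)
    {kp km : ℤ} (hkp : dn F (c + σ) = dn F c + kp * (2 ^ N * ρ))
    (hkm : dn F (c - σ) = dn F c + km * (2 ^ N * ρ)) :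
    -(ρ / 2) ≤ (stepQ F (probAwayA N) (c + σ) (fun y => y)
        + stepQ F (probAwayA N) (c - σ) (fun y => y)) / 2 - stepQ F (probAwayA N) c (fun y => y) ∧
      (stepQ F (probAwayA N) (c + σ) (fun y => y)
        + stepQ F (probAwayA N) (c - σ) (fun y => y)) / 2 - stepQ F (probAwayA N) c (fun y => y)
        ≤ ρ / 2 := by
  rw [stepQA_cell F N hc hd hρ hw, stepQA_cell F N hcp hdp hρ hwp, stepQA_cell F N hcm hdm hρ hwm]
  have ep : c + σ - dn F (c + σ) = (c - dn F c + σ) + ((-(kp * 2 ^ N) : ℤ) : K) * ρ := by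
    rw [hkp]; push_cast; ring
  have em : c - σ - dn F (c - σ) = (c - dn F c - σ) + ((-(km * 2 ^ N) : ℤ) : K) * ρ := by
    rw [hkm]; push_cast; ring
  rw [ep, em, resid_add_mul hρ, resid_add_mul hρ]
  obtain ⟨h1, h2⟩ := resid_two_point hρ σ (y := c - dn F c)
  constructor <;> linarith

/-- Same-cell form: if `c − σ`, `c`, `c + σ` lie in ONE nonnegative cell of width `2^N·ρ`, the
averaged gain is within `±ρ/2`. -/
theorem stepQA_pair_gain_cell (F : Finset K) (N : ℕ) {c σ ρ : K} (hρ : 0 < ρ)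
    (hc : InHull F c) (hcp : InHull F (c + σ)) (hcm : InHull F (c - σ)) (hd : 0 ≤ dn F c)
    (hw : up F c = dn F c + 2 ^ N * ρ)
    (hdp : dn F (c + σ) = dn F c) (hup : up F (c + σ) = up F c)
    (hdm : dn F (c - σ) = dn F c) (hum : up F (c - σ) = up F c) :
    -(ρ / 2) ≤ (stepQ F (probAwayA N) (c + σ) (fun y => y)
        + stepQ F (probAwayA N) (c - σ) (fun y => y)) / 2 - stepQ F (probAwayA N) c (fun y => y) ∧
      (stepQ F (probAwayA N) (c + σ) (fun y => y)
        + stepQ F (probAwayA N) (c - σ) (fun y => y)) / 2 - stepQ F (probAwayA N) c (fun y => y)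
        ≤ ρ / 2 :=
  stepQA_pair_gain F N hρ hc hcp hcm hd (hdp ▸ hd) (hdm ▸ hd) (Or.inr hw)
    (Or.inr (by rw [hdp, hup, hw])) (Or.inr (by rw [hdm, hum, hw]))
    (kp := 0) (km := 0) (by rw [hdp]; simp) (by rw [hdm]; simp)

end LimitedBits

/-! ### Kernel instances: both bounds attained on E3M2 -/

namespace Formats

open LimitedBits

/-- E3M2, one random bit, cells of width `2` on `[8,16)` (`ρ = 1`): with `σ = 1/2` the argument
`43/4` (offset `3/4`) gains exactly `+ρ/2` (`τ: 10 ↦ (11 + 10)/2`) and `41/4` (offset `1/4`) exactly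
`−ρ/2` (`τ: 10 ↦ (10 + 9)/2`); with `σ = 1` (aligned, `σ ∈ ρℤ`) `21/2` gains `0`. -/
theorem e3m2_pair_gain_attained :
    (stepQ e3m2 (probAwayA 1) (43 / 4 + 1 / 2) (fun y => y)
        + stepQ e3m2 (probAwayA 1) (43 / 4 - 1 / 2) (fun y => y)) / 2
        - stepQ e3m2 (probAwayA 1) (43 / 4) (fun y => y) = 1 / 2 ∧
    (stepQ e3m2 (probAwayA 1) (41 / 4 + 1 / 2) (fun y => y)
        + stepQ e3m2 (probAwayA 1) (41 / 4 - 1 / 2) (fun y => y)) / 2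
        - stepQ e3m2 (probAwayA 1) (41 / 4) (fun y => y) = -(1 / 2) ∧
    (stepQ e3m2 (probAwayA 1) (21 / 2 + 1) (fun y => y)
        + stepQ e3m2 (probAwayA 1) (21 / 2 - 1) (fun y => y)) / 2
        - stepQ e3m2 (probAwayA 1) (21 / 2) (fun y => y) = 0 := by
  refine ⟨by decide +kernel, by decide +kernel, by decide +kernel⟩

end Formats

end Summit.Ventures.CertifiedArithmetic.LowPrec.SR
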